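import Literature.AlgebraicGeometry.HodgeTheory.SurjectivePullbackInjective
import Literature.AlgebraicGeometry.HodgeTheory.CorrespondenceSupportedVanishing
import Literature.AlgebraicGeometry.Resolution.ProjectiveResolutionProofs
import Literature.AlgebraicGeometry.Resolution.BaseChangeOverOpens
import Literature.AlgebraicGeometry.Motives.VarietiesGeometricallyIntegralProofs
import HarnessLib

/-!
# A class dying on `Y_j → X` dies on every smooth projective variety mapping into `⋃ g_j(Y_j)`

Topic: `Literature/AlgebraicGeometry/HodgeTheory`. A step of the direct proof of P. Deligne,
*Théorie de Hodge III* (1974), Prop. 8.2.7: let `g_j : Y_j → X` (`j ∈ ι`, finite) be morphisms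
of smooth projective complex varieties and `x' ∈ H^q(X(ℂ); ℂ)` with `g_j^* x' = 0` for all `j`.
Then `φ^* x' = 0` for every morphism `φ : F → X` from a smooth projective (irreducible) `F` whose
image lies in `⋃_j g_j(Y_j)` (`complexBetti_map_eq_zero_of_range_subset_iUnion`).

Proof: `φ(F)` is irreducible, so lies in one `g_j(Y_j)` (the images are closed); an irreducible
component `T₀` of `F ×_X Y_j` dominating `F`, with its reduced structure, is an integral projective
variety, resolved by Hironaka (`Hironaka1964_projective_holds`: `W → T₀` birational from `W`
smooth projective); `W → F` is surjective, so `H^q(F(ℂ)) → H^q(W(ℂ))` is injective (Voisin I,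
Lemma 7.28: `complexBetti_map_injective_of_surjective`), and `W → F → X` factors through `g_j`.
Everything is proved; no named facts (D-0026).

## References

* P. Deligne, *Théorie de Hodge III*, Publ. Math. IHÉS 44 (1974), Prop. 8.2.7.
* C. Voisin, *Hodge Theory and Complex Algebraic Geometry I* (2002), Lemma 7.28.
* J. Kollár, *Lectures on Resolution of Singularities* (2007), Thm. 3.27.
-/

noncomputable section

set_option backward.isDefEq.respectTransparency false

open CategoryTheory CategoryTheory.Limits AlgebraicGeometry TopologicalSpace
open Literature.AlgebraicTopology.SingularHomology Literature.AlgebraicGeometry.Resolution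

namespace Literature.AlgebraicGeometry.HodgeTheory

open Literature.AlgebraicGeometry.Motives

/-- An irreducible set contained in a finite union of closed sets lies in one of them. [folklore] -/
theorem IsIrreducible.exists_subset_of_subset_iUnion_isClosed {α ι : Type*} [TopologicalSpace α]
    [Finite ι] {S : Set α} (hS : IsIrreducible S) {C : ι → Set α} (hC : ∀ j, IsClosed (C j))
    (hSC : S ⊆ ⋃ j, C j) : ∃ j, S ⊆ C j := by
  classical
  haveI := Fintype.ofFinite ι
  obtain ⟨z, hz, hSz⟩ := (isIrreducible_iff_sUnion_isClosed.mp hS) (Finset.univ.image C)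
    (by simp only [Finset.mem_image, Finset.mem_univ, true_and, forall_exists_index,
        forall_apply_eq_imp_iff]; exact hC)
    (by rw [Finset.coe_image, Finset.coe_univ, Set.image_univ, Set.sUnion_range]; exact hSC)
  obtain ⟨j, -, rfl⟩ := Finset.mem_image.mp hz
  exact ⟨j, hSz⟩

/-- **A class killed by every `g_j^*` is killed by `φ^*` for `φ : F → X` with image in
`⋃ g_j(Y_j)`** (`F`, `Y_j` smooth projective). See the module docstring for the proof.
[cite: DeligneHodgeIII1974, Prop. 8.2.7] [cite: VoisinHodgeI2002, Lemma 7.28] [cite: Kollar2007, Thm. 3.27] -/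
theorem complexBetti_map_eq_zero_of_range_subset_iUnion {c nX : ℕ} {F X : SchemeOver ℂ}
    (hF : IsSmoothProjective c F) (hX : IsSmoothProjective nX X) (φ : F ⟶ X)
    {ι : Type} [Finite ι] {m : ι → ℕ} {Y : ι → SchemeOver ℂ}
    (hY : ∀ j, IsSmoothProjective (m j) (Y j)) (g : ∀ j, Y j ⟶ X)
    (hrange : Set.range φ.left ⊆ ⋃ j, Set.range (g j).left)
    {q : ℕ} (x' : complexBetti X q) (hx' : ∀ j, complexBetti.map (g j) q x' = 0) :
    complexBetti.map φ q x' = 0 := by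
  classical
  -- instances
  haveI : IsIntegral F.left := IsSmoothProjective.isIntegral_holds hF
  haveI : IsProper X.hom := hX.isProjectiveOver.isProper
  haveI : IsProper F.hom := hF.isProjectiveOver.isProper
  haveI : ∀ j, IsProper (Y j).hom := fun j ↦ (hY j).isProjectiveOver.isProper
  have hgproper : ∀ j, IsProper (g j).left := fun j ↦ by
    have h : IsProper ((g j).left ≫ X.hom) := by rw [Over.w (g j)]; infer_instance
    exact IsProper.of_comp (g j).left X.hom
  -- `φ(F) ⊆ g_{j₀}(Y_{j₀})`
  have hirr : IsIrreducible (Set.range φ.left) := by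
    rw [← Set.image_univ]
    exact (IrreducibleSpace.isIrreducible_univ F.left).image _ φ.left.continuous.continuousOn
  obtain ⟨j₀, hj₀⟩ := IsIrreducible.exists_subset_of_subset_iUnion_isClosed hirr
    (fun j ↦ by haveI := hgproper j; exact (g j).left.isClosedMap.isClosed_range) hrange
  -- the fibre product `P = F ×_X Y_{j₀}` as a `ℂ`-scheme over `Y_{j₀}`
  haveI := hgproper j₀
  set pr₁ := pullback.fst φ.left (g j₀).left with hpr₁
  set pr₂ := pullback.snd φ.left (g j₀).left with hpr₂
  let PO : SchemeOver ℂ := Over.mk (pr₂ ≫ (Y j₀).hom)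
  have hPOhom : PO.hom = pr₂ ≫ (Y j₀).hom := rfl
  have hcomm : pr₁ ≫ F.hom = pr₂ ≫ (Y j₀).hom := by
    rw [← Over.w φ, ← Category.assoc, hpr₁, pullback.condition, Category.assoc, Over.w (g j₀)]
  let toF : PO ⟶ F := Over.homMk pr₁ hcomm
  let toY : PO ⟶ Y j₀ := Over.homMk pr₂ rfl
  have hsq : toF ≫ φ = toY ≫ g j₀ := by
    ext : 1
    change pr₁ ≫ φ.left = pr₂ ≫ (g j₀).left
    exact pullback.condition
  -- `P` is projective over `ℂ`, hence proper and Noetherian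
  have hPO : IsProjectiveOver PO := by
    have h := isProjectiveOver_pullback φ.left X.hom (g j₀).left (Y j₀).hom (Over.w (g j₀))
      (isProjectiveOver_mk_congr (Over.w φ).symm (isProjectiveOver_mk_hom hF.isProjectiveOver))
      (isProjectiveOver_mk_hom (hY j₀).isProjectiveOver)
    exact h
  haveI : IsProper PO.hom := hPO.isProper
  haveI : IsLocallyNoetherian PO.left := LocallyOfFiniteType.isLocallyNoetherian PO.hom
  haveI : CompactSpace PO.left := by
    have h := QuasiCompact.isCompact_preimage (f := PO.hom) Set.univ isOpen_univ isCompact_univ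
    rw [Set.preimage_univ] at h
    exact isCompact_univ_iff.mp h
  haveI : IsNoetherian PO.left := {}
  haveI : NoetherianSpace PO.left := inferInstance
  -- `pr₁` is surjective and closed
  haveI : IsProper pr₁ := by rw [hpr₁]; infer_instance
  have hsurj₁ : Function.Surjective pr₁ := by
    intro x
    obtain ⟨y, hy⟩ := hj₀ ⟨x, rfl⟩
    obtain ⟨z, hz, -⟩ := Scheme.Pullback.exists_preimage_pullback (f := φ.left) (g := (g j₀).left)
      x y hy.symm
    exact ⟨z, hz⟩
  -- an irreducible component `Z₀` of `P` dominating `F`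
  have hcomp : ∃ Z₀ ∈ irreducibleComponents PO.left, pr₁ '' Z₀ = Set.univ := by
    haveI : Finite (irreducibleComponents PO.left) :=
      (NoetherianSpace.finite_irreducibleComponents (α := PO.left)).to_subtype
    have hcov : (Set.univ : Set F.left) ⊆ ⋃ Z : irreducibleComponents PO.left, pr₁ '' Z.1 := by
      intro x _
      obtain ⟨z, rfl⟩ := hsurj₁ x
      exact Set.mem_iUnion.mpr ⟨⟨irreducibleComponent z, irreducibleComponent_mem_irreducibleComponents z⟩,
        z, mem_irreducibleComponent, rfl⟩
    obtain ⟨Z, hZ⟩ := IsIrreducible.exists_subset_of_subset_iUnion_isClosed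
      (IrreducibleSpace.isIrreducible_univ F.left)
      (fun Z : irreducibleComponents PO.left ↦
        pr₁.isClosedMap _ (isClosed_of_mem_irreducibleComponents Z.1 Z.2)) hcov
    exact ⟨Z.1, Z.2, Set.eq_univ_of_univ_subset hZ⟩
  obtain ⟨Z₀, hZ₀, hZ₀univ⟩ := hcomp
  -- its reduced structure: the integral closed subvariety with generic point that of `Z₀`
  set z₀ : PO.left := hZ₀.1.genericPoint with hz₀
  have hclz₀ : closure ({z₀} : Set PO.left) = Z₀ :=
    hZ₀.1.closure_genericPoint (isClosed_of_mem_irreducibleComponents Z₀ hZ₀)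
  let T₀ : ClosedSubvariety PO.left := ClosedSubvariety.ofPoint PO.left z₀
  have hT₀range : Set.range T₀.ι = Z₀ := by
    rw [ClosedSubvariety.range_ofPoint_ι, hclz₀]
  have hT₀proj : IsProjectiveOver T₀.toSchemeOver := isProjectiveOver_toSchemeOver T₀ hPO
  -- Hironaka: a smooth projective `W → T₀`, birational
  haveI : IsIntegral T₀.toSchemeOver.left := inferInstanceAs (IsIntegral T₀.carrier)
  obtain ⟨d, W, π, hW, hbir, -⟩ := Hironaka1964_projective_holds ℂ T₀.toSchemeOver hT₀proj
  -- the composite `h : W → T₀ → P → F` is surjective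
  let h : W ⟶ F := π ≫ T₀.ιOver ≫ toF
  haveI : IsProper W.hom := hW.isProjectiveOver.isProper
  haveI : IsProper T₀.toSchemeOver.hom := hT₀proj.isProper
  haveI : IsProper π.left := by
    have hp : IsProper (π.left ≫ T₀.toSchemeOver.hom) := by rw [Over.w π]; infer_instance
    exact IsProper.of_comp π.left T₀.toSchemeOver.hom
  haveI : Surjective h.left := by
    refine ⟨fun x ↦ ?_⟩
    have hx : x ∈ pr₁ '' Z₀ := by rw [hZ₀univ]; trivial
    obtain ⟨z, hz, rfl⟩ := hx
    rw [← hT₀range] at hz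
    obtain ⟨t, rfl⟩ := hz
    -- `π` is surjective: proper and birational (image closed and dense; cf. the tree's
    -- `surjective_base_of_isBirational` in `SupportedHodgeClassDescent`, not imported here)
    have hπsurj : Function.Surjective π.left := by
      haveI : IsDominant π.left := by
        obtain ⟨U, hU, -, hiso⟩ := hbir
        haveI := hiso
        haveI : IsDominant U.ι := ⟨by rw [DenseRange, Scheme.Opens.range_ι]; exact hU⟩
        haveI : IsDominant ((π.left ⁻¹ᵁ U).ι ≫ π.left) := by
          rw [← morphismRestrict_ι]
          infer_instance
        exact IsDominant.of_comp (π.left ⁻¹ᵁ U).ι π.left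
      haveI := surjective_of_isDominant_of_isClosed_range π.left π.left.isClosedMap.isClosed_range
      exact π.left.surjective
    obtain ⟨w, rfl⟩ := hπsurj t
    exact ⟨w, rfl⟩
  -- conclude by the injectivity of `h^*`
  have hinj := complexBetti_map_injective_of_surjective hF hW h q
  apply hinj
  rw [map_zero, ← ModuleCat.comp_apply, ← complexBetti.map_comp]
  have hfac : h ≫ φ = (π ≫ T₀.ιOver ≫ toY) ≫ g j₀ := by
    simp only [h, Category.assoc, hsq]
  rw [hfac, complexBetti.map_comp, ModuleCat.comp_apply, hx' j₀, map_zero]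

end Literature.AlgebraicGeometry.HodgeTheory
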